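import Mathlib
import Summits.PneNP.PneNP.Theorems.OverlapGapAlgebraNoStableSection
import Summits.PneNP.PneNP.Theorems.OverlapGapAlgebraSolvableImpliesStableSectionMeanSquareTransferUniform

/-!
# PneNP / OverlapGapAlgebra — `SearchHardWindow` (stmt-PneNP-2460): NECESSARY INSTABILITY of any
# successful search map in the Bresler–Huang window

Support for crux `stmt-PneNP-2460` (`Summit.PneNP.PneNP.Theses.OverlapGapAlgebra.SearchHardWindow`).
The class rungs say which algorithms FAIL in the window. Read contrapositively and made uniform in the
map, the mean-square machinery says what any algorithm that SUCCEEDS there must look like — in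
particular the hypothetical polynomial-time solver whose non-existence the crux asserts:
UNCONDITIONALLY (via the proved `NoStableSection`), for `k ≥ k₀` there are `C, δ > 0` such that for all
large `n`, EVERY map `g` on `F_k(n, ⌊α_k n⌋)` (`α_k = 5·2^k log k/k`) satisfies

  success ratio `> C(1 + s log² n)/n`  ⟹  `∑_{(a,b)} ∑_{(Φ,ℓ)} d_H(g Φ, g Φ[(a,b) ↦ ℓ])² > s·(m k)·#Inst·2n`

for every level `0 ≤ s ≤ δ n / log³ n` (`shwMSU_sensitivity_lb_of_success`); at the top level: success
ratio `> C(1/n + δ/log n)` forces root-mean-square single-literal-resample sensitivity `> √(δ n / log³ n)`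
(`shwMSU_sensitivity_lb_saturated`) — resampling ONE of the `k m` literals must move the output by
`Ω̃(√n)` bits in quadratic mean. Equivalently (`shwMSU_successCount_le`): the success bound
`C(1 + s log² n)/n` of the mean-square rung holds UNIFORMLY over all maps and all levels `s ≤ δn/log³n` at
every large `n` (the threshold in `n` does not depend on the map or the level).
No new definitions; axioms `propext`, `Classical.choice`, `Quot.sound`.
-/

set_option linter.dupNamespace false -- `Summit.PneNP.PneNP.…`: summit = sub-problem (D-0017)

namespace Summit.PneNP.PneNP.Theorems

open Finset Filter Asymptotics
open scoped Classical

/-- **Uniform mean-square success bound in the window, modulo `NoStableSection`.** For `k ≥ k₀` there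
are `C, δ > 0` such that, eventually in `n` (a threshold depending on `k` only), for EVERY map `g` on
`F_k(n, ⌊α_k n⌋)` and EVERY level `s` with `0 ≤ s`, `s log³ n ≤ δ n` and
`∑_{(a,b)} ∑_{(Φ,ℓ)} d_H(g Φ, g Φ[(a,b) ↦ ℓ])² ≤ s·(m k)·#Inst·2n`: `g` solves at most
`C(1 + s log² n)/n · #Inst` instances. -/
theorem shwMSU_successCount_le_of_noStableSection
    (hNo : Summit.PneNP.PneNP.Theses.OverlapGapAlgebra.NoStableSection) :
    ∃ k₀ : ℕ, ∀ k : ℕ, k₀ ≤ k → ∃ C : ℝ, 0 < C ∧ ∃ δ : ℝ, 0 < δ ∧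
      ∀ᶠ n : ℕ in atTop, ∀ m : ℕ, m = ⌊5 * 2 ^ k * Real.log k / k * n⌋₊ →
        ∀ g : (Fin m → Fin k → Fin n × Bool) → (Fin n → Bool), ∀ s : ℝ, 0 ≤ s →
          s * Real.log n ^ 3 ≤ δ * n →
          (∑ a : Fin m, ∑ b : Fin k, ∑ p : (Fin m → Fin k → Fin n × Bool) × (Fin n × Bool),
            (hammingDist (g p.1) (g (Function.update p.1 a (Function.update (p.1 a) b p.2))) : ℝ) ^ 2)
            ≤ s * (((m * k : ℕ) : ℝ) * (Fintype.card (Fin m → Fin k → Fin n × Bool) * (2 * n))) →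
          ((Finset.univ.filter fun Φ : Fin m → Fin k → Fin n × Bool =>
              ∀ i, ∃ j, g Φ (Φ i j).1 = (Φ i j).2).card : ℝ)
            ≤ C * (1 + Real.log n ^ 2 * s) / n * Fintype.card (Fin m → Fin k → Fin n × Bool) := by
  obtain ⟨k₀, hk₀⟩ := hNo
  refine ⟨max k₀ 2, fun k hk => ?_⟩
  have hk₀k : k₀ ≤ k := le_trans (le_max_left _ _) hk
  have hk2 : 2 ≤ k := le_trans (le_max_right _ _) hk
  have hk1 : 1 ≤ k := le_trans (by norm_num) hk2
  have hk0 : (0 : ℝ) < k := by exact_mod_cast (lt_of_lt_of_le Nat.zero_lt_one hk1)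
  obtain ⟨η, hη, ν, hν, c, hc, hNSS⟩ := hk₀ k hk₀k
  set α : ℝ := 5 * 2 ^ k * Real.log k / k with hαdef
  have hαpos : 0 < α := by
    have hk2R : (2 : ℝ) ≤ k := by exact_mod_cast hk2
    have hlogk : 0 < Real.log k := Real.log_pos (by linarith only [hk2R])
    rw [hαdef]; positivity
  have hν2 : 0 < ν ^ 2 := by positivity
  have hc2 : 0 < c / 2 := by positivity
  -- the small constant `δ` for the rate `c/2`
  obtain ⟨δ, hδpos, hδa, hδη, hδc, hδb⟩ : ∃ δ : ℝ, 0 < δ ∧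
      δ ≤ 1 * ν ^ 2 * α / (144 * k) ∧ δ ≤ η ^ 2 / (k * α) ∧ δ ≤ (c / 2) * ν ^ 2 / (576 * k ^ 3) ∧
      δ ≤ α * ν ^ 2 / (288 * k) := by
    refine ⟨min (1 * ν ^ 2 * α / (144 * k))
      (min (η ^ 2 / (k * α)) (min ((c / 2) * ν ^ 2 / (576 * k ^ 3)) (α * ν ^ 2 / (288 * k)))), ?_,
      min_le_left _ _, (min_le_right _ _).trans (min_le_left _ _),
      ((min_le_right _ _).trans (min_le_right _ _)).trans (min_le_left _ _),
      ((min_le_right _ _).trans (min_le_right _ _)).trans (min_le_right _ _)⟩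
    refine lt_min ?_ (lt_min ?_ (lt_min ?_ ?_)) <;> positivity
  refine ⟨144 * k / (ν ^ 2 * α), by positivity, δ, hδpos, ?_⟩
  have hlarge : ∀ᶠ n : ℕ in atTop, 2 / α ≤ (n : ℝ) :=
    tendsto_natCast_atTop_atTop.eventually_ge_atTop _
  filter_upwards [sissMSU_eventually k α ν (c / 2) hν hc2, hNSS, hlarge, eventually_ge_atTop 1]
    with n hcond hNn hnα hn1 m hm g s hs0 hs1 hS
  obtain ⟨hn3, hC3, hC4, hC5, hC7, hC8⟩ := hcond
  by_contra hcon
  push Not at hcon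
  -- the threshold of the uniform transfer is below the rate
  have hnpos : (0 : ℝ) < n := by
    have : 0 < 2 / α := by positivity
    exact this.trans_le hnα
  have hαn2 : 2 ≤ α * n := by
    have h := (div_le_iff₀ hαpos).1 hnα
    linarith only [h]
  have hm_ge : α * n - 1 ≤ m := by
    rw [hm]; have := Nat.lt_floor_add_one (α * n); linarith only [this]
  have hm2 : α * n / 2 ≤ m := by linarith only [hm_ge, hαn2]
  have hmpos : (0 : ℝ) < m := by
    have : 0 < α * n / 2 := by positivity
    exact this.trans_le hm2
  have hx : 0 ≤ Real.log n ^ 2 * s := by positivity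
  have hthr_le : 8 * k * (2 + 9 * Real.log n ^ 2 * s) / (ν ^ 2 * m)
      ≤ 144 * k / (ν ^ 2 * α) * (1 + Real.log n ^ 2 * s) / n := by
    have h1 : 8 * k * (2 + 9 * Real.log n ^ 2 * s) / (ν ^ 2 * m)
        ≤ 8 * k * (2 + 9 * Real.log n ^ 2 * s) / (ν ^ 2 * (α * n / 2)) := by
      apply div_le_div_of_nonneg_left (by positivity) (by positivity)
      exact mul_le_mul_of_nonneg_left hm2 hν2.le
    have hν0 : ν ≠ 0 := hν.ne'
    have hα0 : α ≠ 0 := hαpos.ne'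
    have hn0 : (n : ℝ) ≠ 0 := hnpos.ne'
    have h2 : 8 * k * (2 + 9 * Real.log n ^ 2 * s) / (ν ^ 2 * (α * n / 2))
        = 16 * k * (2 + 9 * Real.log n ^ 2 * s) / (ν ^ 2 * α * n) := by
      field_simp
      ring
    have h3 : 16 * (k : ℝ) * (2 + 9 * Real.log n ^ 2 * s) ≤ 144 * k * (1 + Real.log n ^ 2 * s) := by
      nlinarith only [hk0, hx]
    have h4 : 16 * k * (2 + 9 * Real.log n ^ 2 * s) / (ν ^ 2 * α * n)
        ≤ 144 * k * (1 + Real.log n ^ 2 * s) / (ν ^ 2 * α * n) :=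
      div_le_div_of_nonneg_right h3 (by positivity)
    have h5 : 144 * k * (1 + Real.log n ^ 2 * s) / (ν ^ 2 * α * n)
        = 144 * k / (ν ^ 2 * α) * (1 + Real.log n ^ 2 * s) / n := by
      field_simp
    calc 8 * k * (2 + 9 * Real.log n ^ 2 * s) / (ν ^ 2 * m)
        ≤ 8 * k * (2 + 9 * Real.log n ^ 2 * s) / (ν ^ 2 * (α * n / 2)) := h1
      _ = 16 * k * (2 + 9 * Real.log n ^ 2 * s) / (ν ^ 2 * α * n) := h2
      _ ≤ 144 * k * (1 + Real.log n ^ 2 * s) / (ν ^ 2 * α * n) := h4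
      _ = 144 * k / (ν ^ 2 * α) * (1 + Real.log n ^ 2 * s) / n := h5
  have hsucc : 8 * k * (2 + 9 * Real.log n ^ 2 * s) / (ν ^ 2 * m)
        * Fintype.card (Fin m → Fin k → Fin n × Bool) ≤
      ((Finset.univ.filter fun Φ : Fin m → Fin k → Fin n × Bool =>
        ∀ i, ∃ j, g Φ (Φ i j).1 = (Φ i j).2).card : ℝ) :=
    le_trans (mul_le_mul_of_nonneg_right hthr_le (Nat.cast_nonneg _)) hcon.le
  -- the uniform transfer at this `n`, against `NoStableSection` at this `n`
  have hev := sissMSU_pathEvent k hk1 α η ν (c / 2) δ hαpos hη hν hc2 hδa hδη hδc hδb n m hn3 hC3 hC4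
    hC5 hC7 hC8 hm s hs0 hs1 g hS hsucc
  have hup := hNn m hm g
  have key : Real.exp (-(c / 2 * n)) * (Fintype.card (Fin (k + 1) → Fin m → Fin k → Fin n × Bool) : ℝ)
      ≤ Real.exp (-(c * n)) * (Fintype.card (Fin (k + 1) → Fin m → Fin k → Fin n × Bool) : ℝ) :=
    hev.trans (((Nat.cast_le (α := ℝ)).2 (Finset.card_le_card fun Ψ h => by simpa using h)).trans hup)
  haveI : Nonempty (Fin n × Bool) := ⟨(⟨0, hn1⟩, true)⟩
  have hP : (0 : ℝ) < (Fintype.card (Fin (k + 1) → Fin m → Fin k → Fin n × Bool) : ℝ) := by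
    exact_mod_cast Fintype.card_pos
  have hexp := le_of_mul_le_mul_right key hP
  rw [Real.exp_le_exp] at hexp
  have hcn : 0 < c * n := by positivity
  linarith only [hexp, hcn]

/-- **Uniform mean-square success bound in the window (unconditional).** For `k ≥ k₀` there are
`C, δ > 0` such that, eventually in `n`, every map `g` on `F_k(n, ⌊α_k n⌋)` with
`∑_{(a,b)} ∑_{(Φ,ℓ)} d_H(g Φ, g Φ[(a,b) ↦ ℓ])² ≤ s·(m k)·#Inst·2n` for some `0 ≤ s ≤ δ n/log³ n` solves
at most a `C(1 + s log² n)/n` fraction of the instances — with one threshold in `n` for all maps and all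
levels. -/
theorem shwMSU_successCount_le :
    ∃ k₀ : ℕ, ∀ k : ℕ, k₀ ≤ k → ∃ C : ℝ, 0 < C ∧ ∃ δ : ℝ, 0 < δ ∧
      ∀ᶠ n : ℕ in atTop, ∀ m : ℕ, m = ⌊5 * 2 ^ k * Real.log k / k * n⌋₊ →
        ∀ g : (Fin m → Fin k → Fin n × Bool) → (Fin n → Bool), ∀ s : ℝ, 0 ≤ s →
          s * Real.log n ^ 3 ≤ δ * n →
          (∑ a : Fin m, ∑ b : Fin k, ∑ p : (Fin m → Fin k → Fin n × Bool) × (Fin n × Bool),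
            (hammingDist (g p.1) (g (Function.update p.1 a (Function.update (p.1 a) b p.2))) : ℝ) ^ 2)
            ≤ s * (((m * k : ℕ) : ℝ) * (Fintype.card (Fin m → Fin k → Fin n × Bool) * (2 * n))) →
          ((Finset.univ.filter fun Φ : Fin m → Fin k → Fin n × Bool =>
              ∀ i, ∃ j, g Φ (Φ i j).1 = (Φ i j).2).card : ℝ)
            ≤ C * (1 + Real.log n ^ 2 * s) / n * Fintype.card (Fin m → Fin k → Fin n × Bool) :=
  shwMSU_successCount_le_of_noStableSection noStableSection_proof

/-- **Necessary instability of successful search maps in the window (unconditional).** For `k ≥ k₀`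
there are `C, δ > 0` such that, eventually in `n`, EVERY map `g` on `F_k(n, ⌊α_k n⌋)`,
`α_k = 5·2^k log k/k`, that solves more than a `C(1 + s log² n)/n` fraction of the instances, for a level
`0 ≤ s ≤ δ n / log³ n`, has mean-square single-literal-resample sensitivity MORE than `s`:
`∑_{(a,b)} ∑_{(Φ,ℓ)} d_H(g Φ, g Φ[(a,b) ↦ ℓ])² > s·(m k)·#Inst·2n`. In particular any polynomial-time
solver succeeding with constant probability in the window — the object `SearchHardWindow` says does not
exist — would have to be unstable at every such scale. -/
theorem shwMSU_sensitivity_lb_of_success :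
    ∃ k₀ : ℕ, ∀ k : ℕ, k₀ ≤ k → ∃ C : ℝ, 0 < C ∧ ∃ δ : ℝ, 0 < δ ∧
      ∀ᶠ n : ℕ in atTop, ∀ m : ℕ, m = ⌊5 * 2 ^ k * Real.log k / k * n⌋₊ →
        ∀ g : (Fin m → Fin k → Fin n × Bool) → (Fin n → Bool), ∀ s : ℝ, 0 ≤ s →
          s * Real.log n ^ 3 ≤ δ * n →
          C * (1 + Real.log n ^ 2 * s) / n * Fintype.card (Fin m → Fin k → Fin n × Bool)
            < ((Finset.univ.filter fun Φ : Fin m → Fin k → Fin n × Bool =>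
                ∀ i, ∃ j, g Φ (Φ i j).1 = (Φ i j).2).card : ℝ) →
          s * (((m * k : ℕ) : ℝ) * (Fintype.card (Fin m → Fin k → Fin n × Bool) * (2 * n)))
            < (∑ a : Fin m, ∑ b : Fin k, ∑ p : (Fin m → Fin k → Fin n × Bool) × (Fin n × Bool),
                (hammingDist (g p.1) (g (Function.update p.1 a (Function.update (p.1 a) b p.2))) : ℝ) ^ 2) := by
  obtain ⟨k₀, h⟩ := shwMSU_successCount_le
  refine ⟨k₀, fun k hk => ?_⟩
  obtain ⟨C, hC, δ, hδ, hmain⟩ := h k hk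
  refine ⟨C, hC, δ, hδ, ?_⟩
  filter_upwards [hmain] with n hn m hm g s hs0 hs1 hsucc
  by_contra hle
  push Not at hle
  exact absurd (hn m hm g s hs0 hs1 hle) (not_le.2 hsucc)

/-- **Necessary instability, saturated form.** For `k ≥ k₀` there are `C, δ > 0` such that, eventually
in `n`, every map on `F_k(n, ⌊α_k n⌋)` solving more than a `C(1/n + δ/log n)`-fraction of the instances
has `∑_{(a,b)} ∑_{(Φ,ℓ)} d_H(g Φ, g Φ[(a,b) ↦ ℓ])² > (δ n/log³ n)·(m k)·#Inst·2n`: its root-mean-square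
single-literal-resample sensitivity exceeds `√(δ n / log³ n)`. -/
theorem shwMSU_sensitivity_lb_saturated :
    ∃ k₀ : ℕ, ∀ k : ℕ, k₀ ≤ k → ∃ C : ℝ, 0 < C ∧ ∃ δ : ℝ, 0 < δ ∧
      ∀ᶠ n : ℕ in atTop, ∀ m : ℕ, m = ⌊5 * 2 ^ k * Real.log k / k * n⌋₊ →
        ∀ g : (Fin m → Fin k → Fin n × Bool) → (Fin n → Bool),
          C * (1 / n + δ / Real.log n) * Fintype.card (Fin m → Fin k → Fin n × Bool)
            < ((Finset.univ.filter fun Φ : Fin m → Fin k → Fin n × Bool =>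
                ∀ i, ∃ j, g Φ (Φ i j).1 = (Φ i j).2).card : ℝ) →
          δ * n / Real.log n ^ 3
              * (((m * k : ℕ) : ℝ) * (Fintype.card (Fin m → Fin k → Fin n × Bool) * (2 * n)))
            < (∑ a : Fin m, ∑ b : Fin k, ∑ p : (Fin m → Fin k → Fin n × Bool) × (Fin n × Bool),
                (hammingDist (g p.1) (g (Function.update p.1 a (Function.update (p.1 a) b p.2))) : ℝ) ^ 2) := by
  obtain ⟨k₀, h⟩ := shwMSU_sensitivity_lb_of_success
  refine ⟨k₀, fun k hk => ?_⟩
  obtain ⟨C, hC, δ, hδ, hmain⟩ := h k hk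
  refine ⟨C, hC, δ, hδ, ?_⟩
  filter_upwards [hmain, eventually_ge_atTop 2] with n hn hn2 m hm g hsucc
  have hn2R : (2 : ℝ) ≤ n := by exact_mod_cast hn2
  have hnpos : (0 : ℝ) < n := by linarith only [hn2R]
  have hlogpos : 0 < Real.log n := Real.log_pos (by linarith only [hn2R])
  have hL0 : Real.log n ≠ 0 := hlogpos.ne'
  have hs0 : 0 ≤ δ * n / Real.log n ^ 3 := by positivity
  have hs1 : δ * n / Real.log n ^ 3 * Real.log n ^ 3 ≤ δ * n := by
    rw [div_mul_cancel₀ _ (pow_ne_zero 3 hL0)]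
  refine hn m hm g (δ * n / Real.log n ^ 3) hs0 hs1 ?_
  have hrew : C * (1 + Real.log n ^ 2 * (δ * n / Real.log n ^ 3)) / n = C * (1 / n + δ / Real.log n) := by
    field_simp
  rw [hrew]
  exact hsucc

/-- **What a window solver must look like (crux vocabulary, unconditional).** For `k ≥ k₀` there is
`δ > 0` such that for ANY `f : List Bool → List Bool` (in particular any polynomial-time one) that solves
`F_k(n, ⌊α_k n⌋)` with probability `≥ ε > 0` for infinitely many `n` — the hypothesis that the hardness
conjunct of `SearchHardWindow` says is never met — the decoded sections
`g_n : Φ ↦ (v ↦ (f ⌜Φ⌝).getD v false)` have, for infinitely many `n`, mean-square single-literal-resample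
sensitivity MORE than `δ n / log³ n`:
`∑_{(a,b)} ∑_{(Φ,ℓ)} d_H(g_n Φ, g_n Φ[(a,b) ↦ ℓ])² > (δ n/log³ n)·(m k)·#Inst·2n`. -/
theorem shwMSU_unstable_of_solvable :
    ∃ k₀ : ℕ, ∀ k : ℕ, k₀ ≤ k → ∃ δ : ℝ, 0 < δ ∧ ∀ (f : List Bool → List Bool) (ε : ℝ), 0 < ε →
      (∃ᶠ n : ℕ in Filter.atTop, ∀ m : ℕ, m = ⌊5 * 2 ^ k * Real.log k / k * n⌋₊ → ε ≤
        ((Finset.univ.filter fun Φ : Fin m → Fin k → Fin n × Bool => ∀ i, ∃ j,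
          (f (Literature.Computability.Complexity.encodingCNF.encode (List.ofFn fun a =>
            List.ofFn fun b => (((Φ a b).1 : ℕ), (Φ a b).2)))).getD (Φ i j).1 false =
              (Φ i j).2).card : ℝ) / Fintype.card (Fin m → Fin k → Fin n × Bool)) →
      ∃ᶠ n : ℕ in Filter.atTop, ∀ m : ℕ, m = ⌊5 * 2 ^ k * Real.log k / k * n⌋₊ →
        ∀ g : (Fin m → Fin k → Fin n × Bool) → (Fin n → Bool),
          (∀ (Φ : Fin m → Fin k → Fin n × Bool) (v : Fin n), g Φ v =
            (f (Literature.Computability.Complexity.encodingCNF.encode (List.ofFn fun a =>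
              List.ofFn fun b => (((Φ a b).1 : ℕ), (Φ a b).2)))).getD v false) →
          δ * n / Real.log n ^ 3
              * (((m * k : ℕ) : ℝ) * (Fintype.card (Fin m → Fin k → Fin n × Bool) * (2 * n)))
            < (∑ a : Fin m, ∑ b : Fin k, ∑ p : (Fin m → Fin k → Fin n × Bool) × (Fin n × Bool),
                (hammingDist (g p.1) (g (Function.update p.1 a (Function.update (p.1 a) b p.2))) : ℝ) ^ 2) := by
  obtain ⟨k₀, h⟩ := shwMSU_sensitivity_lb_saturated
  refine ⟨k₀, fun k hk => ?_⟩
  obtain ⟨C, hC, δ, hδ, hmain⟩ := h k hk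
  refine ⟨δ, hδ, fun f ε hε hfreq => ?_⟩
  -- eventually `C(1/n + δ/log n) < ε`
  have E1 : ∀ᶠ n : ℕ in atTop, 3 * C / ε ≤ (n : ℝ) :=
    tendsto_natCast_atTop_atTop.eventually_ge_atTop _
  have E2 : ∀ᶠ n : ℕ in atTop, 3 * C * δ / ε ≤ Real.log n :=
    (Real.tendsto_log_atTop.comp tendsto_natCast_atTop_atTop).eventually_ge_atTop _
  refine (hfreq.and_eventually (hmain.and (E1.and (E2.and (eventually_ge_atTop 2))))).mono ?_
  rintro n ⟨hn, hmn, h1, h2, hn2⟩ m hm g hgf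
  have hn2R : (2 : ℝ) ≤ n := by exact_mod_cast hn2
  have hnpos : (0 : ℝ) < n := by linarith only [hn2R]
  have hlogpos : 0 < Real.log n := Real.log_pos (by linarith only [hn2R])
  haveI : Nonempty (Fin n × Bool) := ⟨(⟨0, le_trans (by norm_num) hn2⟩, false)⟩
  have hN : (0 : ℝ) < Fintype.card (Fin m → Fin k → Fin n × Bool) := by
    exact_mod_cast Fintype.card_pos
  refine hmn m hm g ?_
  -- success count of `g` = success count of `f`
  have hsucc := hn m hm
  rw [le_div_iff₀ hN] at hsucc
  have hset : ((Finset.univ.filter fun Φ : Fin m → Fin k → Fin n × Bool => ∀ i, ∃ j,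
      (f (Literature.Computability.Complexity.encodingCNF.encode (List.ofFn fun a =>
        List.ofFn fun b => (((Φ a b).1 : ℕ), (Φ a b).2)))).getD (Φ i j).1 false = (Φ i j).2))
      = (Finset.univ.filter fun Φ : Fin m → Fin k → Fin n × Bool =>
          ∀ i, ∃ j, g Φ (Φ i j).1 = (Φ i j).2) := by
    refine Finset.filter_congr fun Φ _ => ?_
    simp only [hgf]
  rw [hset] at hsucc
  refine lt_of_lt_of_le ?_ hsucc
  apply mul_lt_mul_of_pos_right _ hN
  -- `C (1/n + δ/log n) < ε`
  have ha : C * (1 / n) ≤ ε / 3 := by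
    rw [div_le_iff₀ hε] at h1
    rw [mul_one_div, div_le_iff₀ hnpos]
    linarith only [h1]
  have hb : C * (δ / Real.log n) ≤ ε / 3 := by
    rw [div_le_iff₀ hε] at h2
    rw [mul_div_assoc', div_le_iff₀ hlogpos]
    linarith only [h2]
  calc C * (1 / n + δ / Real.log n) = C * (1 / n) + C * (δ / Real.log n) := by ring
    _ ≤ ε / 3 + ε / 3 := add_le_add ha hb
    _ < ε := by linarith only [hε]

end Summit.PneNP.PneNP.Theorems
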